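import Literature.NumberTheory.DiophantineApproximation.RhinViolaDoubleResidue
import Literature.NumberTheory.DiophantineApproximation.RhinViolaInvolution
import HarnessLib

/-!
# Rhin–Viola 2005, Lemma 2.5: the tuples `(0, 0, 0, l, 0)` reduce to `(0, 0, l, 0, 0)` (Lemma 2.4) by `λ`

Topic `Literature/NumberTheory/DiophantineApproximation`. Everything here is PROVED (no definitions, no named
facts). Source: G. Rhin, C. Viola, *The permutation group method for the dilogarithm*, Ann. Sc. Norm. Super.
Pisa Cl. Sci. (5) 4 (2005) 389–437, Lemma 2.5 (p. 399): "If `h = j = k = m = 0` then Theorem 2.1 holds, with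
`Q = 0` if `l > 0`. Proof. If `l = 0` we apply Lemma 2.3. If `l > 0` the result follows from Lemma 2.4 by
applying the permutation `λ`", i.e. from `I_z^{(ν)}(0,0,0,l,0) = I_z^{(ν)}(0,0,l,0,0)` (`ν = 0, 1, 2`; (2.6)).

For `ν = 0` this is the tree's `I0_lam` (the change of variables (2.5) on the square). For the contour
members, which the tree defines in residue form, we verify the three equalities directly: the inner residue
at `(0,0,0,l,0)` is `(1−y₀)^l/(z−x) = z^l/(z−x)^{l+1}` (`1 − y₀ = z/(z−x)`), i.e. `z^l` times the inner residue
`1/(z−x)^{l+1}` at `(0,0,l,0,0)`, and the normalisations `z^{−l}`, `z^0` compensate; both double residues vanish.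

## References

* G. Rhin, C. Viola, Ann. Sc. Norm. Super. Pisa Cl. Sci. (5) 4 (2005) 389–437, Lemma 2.5, (2.6). [RhinViola2005]
-/

noncomputable section

namespace Literature.NumberTheory.DiophantineApproximation

namespace RhinViola

open _root_.MeasureTheory _root_.Set intervalIntegral Finset Polynomial

/-- The inner residue at `(0,0,0,l,0)`: `(1−y₀)^l/(z−x) = z^l/(z−x)^{l+1} = z^l · innerRes(0,l,0,0)` (`x ≠ z`).
[cite: RhinViola2005, (2.6) and (2.10)] -/
theorem innerRes_zero_zero_l_zero {x z : ℝ} (hxz : x ≠ z) (l : ℕ) :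
    innerRes z 0 0 l 0 x = z ^ l * innerRes z 0 l 0 0 x := by
  have hxz' : x - z ≠ 0 := sub_ne_zero.2 hxz
  have hzx : z - x ≠ 0 := sub_ne_zero.2 (Ne.symm hxz)
  rw [innerRes_zero_k, innerRes, if_pos (le_refl _)]
  simp only [Nat.sub_zero, pow_zero, one_mul, hasseDeriv_zero', eval_pow, eval_sub, eval_one, eval_X, zero_add,
    pow_one]
  rw [show 1 - x / (x - z) = z / (z - x) by field_simp; ring, div_pow, pow_succ]
  field_simp

/-- **(2.6), `ν = 1`, at `(0,0,0,l,0)`**: `I_z^{(1)}(0,0,0,l,0) = I_z^{(1)}(0,0,l,0,0)` for `z > 1`.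
[cite: RhinViola2005, (2.6)] -/
theorem I1_zero_zero_zero_l_zero {z : ℝ} (hz : 1 < z) (l : ℕ) : I1 z 0 0 0 l 0 = I1 z 0 0 l 0 0 := by
  have hz0 : z ≠ 0 := by positivity
  have hint : ∫ x in (0 : ℝ)..1, x ^ 0 * (1 - x) ^ 0 * innerRes z 0 0 l 0 x =
      z ^ l * ∫ x in (0 : ℝ)..1, x ^ 0 * (1 - x) ^ 0 * innerRes z 0 l 0 0 x := by
    rw [← intervalIntegral.integral_const_mul]
    refine integral_congr fun x hx => ?_
    have hxz : x ≠ z := by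
      rw [Set.uIcc_of_le zero_le_one] at hx
      intro h; linarith [hx.2]
    simp only [pow_zero, one_mul]
    exact innerRes_zero_zero_l_zero hxz l
  rw [I1, I1, hint]
  simp only [Nat.cast_zero, add_zero, neg_zero, zpow_zero, one_mul, zpow_neg, zpow_natCast]
  field_simp

/-- **(2.6), `ν = 2`, at `(0,0,0,l,0)`** (`l ≥ 1`): `I_z^{(2)}(0,0,0,l,0) = 0 = I_z^{(2)}(0,0,l,0,0)`.
[cite: RhinViola2005, (2.6) and (2.15)] -/
theorem I2_zero_zero_zero_l_zero (z : ℝ) {l : ℕ} (hl : 0 < l) : I2 z 0 0 0 l 0 = I2 z 0 0 l 0 0 := by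
  rw [I2_zero_k z hl, I2, if_pos (le_refl _)]
  refine mul_eq_zero_of_right _ (mul_eq_zero_of_right _ (sum_eq_zero fun i _ => ?_))
  simp only [Nat.add_zero, Nat.sub_zero, pow_zero, one_mul, mul_one, hasseDeriv_zero']
  rcases Nat.eq_zero_or_pos i with rfl | hi
  · -- the constant coefficient of `((1−Y) ∘ (1 + zW))^… = (−zW)^l` vanishes for `l ≥ 1`
    have : (((1 - X : ℝ[X]) ^ l).comp (1 + C z * X)).coeff 0 = 0 := by
      rw [coeff_zero_eq_eval_zero, eval_comp]
      simp [zero_pow hl.ne']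
    rw [this, zero_mul]
  · rw [hasseDeriv_apply_one _ hi, eval_zero, mul_zero]

/-- **(2.6), `ν = 0`, at `(0,0,0,l,0)`** (the tree's `I0_lam`): `I_z^{(0)}(0,0,0,l,0) = I_z^{(0)}(0,0,l,0,0)`, `z ≥ 1`.
[cite: RhinViola2005, (2.6)] -/
theorem I0_zero_zero_zero_l_zero {z : ℝ} (hz : 1 ≤ z) (l : ℕ) : I0 z 0 0 0 l 0 = I0 z 0 0 l 0 0 :=
  I0_lam hz 0 0 l 0 0

/-- **(2.7) at `(0,0,0,l,0)`**: `I_z(0,0,0,l,0) = I_z(0,0,l,0,0)` for `z > 1`. [cite: RhinViola2005, (2.7)] -/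
theorem I_zero_zero_zero_l_zero {z : ℝ} (hz : 1 < z) (l : ℕ) : I z 0 0 0 l 0 = I z 0 0 l 0 0 := by
  rw [I, I, I0_zero_zero_zero_l_zero hz.le, I1_zero_zero_zero_l_zero hz]

end RhinViola

end Literature.NumberTheory.DiophantineApproximation

end
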